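import Literature.AlgebraicGeometry.Motives.HodgeThetaSubalgebraUnitarySocket
import Literature.AlgebraicGeometry.Motives.SpanCLieEquivBaseChange
import Literature.Algebra.Lie.KillingBaseChange
import Mathlib.Algebra.DirectSum.LinearMap
import Mathlib.Algebra.Lie.Killing
import HarnessLib

/-!
# The unitary `Θ`-subalgebra programme — transfer lemmas: traces through the perfect pairing `W × W′ → ℂ`
# (`tr_{V_ℂ} = 2·tr_W` on products of `φ_ℂ`-commuting `ψ_ℂ`-skew operators) and rationality of the Killing form on rational
# pairs (Ribet 1983 Thm. 3 / Moonen–Zarhin 1999 (2.3)–(2.4), Type IV(1,1); Deligne LNM 900 I §3; Jacobson X §1)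

Topic `Literature/AlgebraicGeometry/Motives` (namespace `Literature.AlgebraicGeometry.Motives.HodgeStructure`).  Theorems only
(no definition, no named fact; D-0026).  Written for the cell `pub-hodgeav-hg6` (req-37 (A) row 2, TABLE X row 8-`(4,2)`; brick U1c
of the `(4,2)` programme, lead g2 2026-08-28T21:16:44Z; honest framing of that cell: HC / HC_AV / HC_CM / H2 NOT proved — THIS
file is unconditional linear algebra and discharges no hypothesis of the cell's cover).

PURPOSE.  The complex core of the `(4,2)` programme (U2, open) lives in `End(W)`, `W = ker(φ_ℂ − μ)`, and measures its
skeleton with the trace form `tr_W` and the Killing form of the restriction algebra; the radical kill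
(`HodgeThetaSubalgebraRadicalKill`) lives on `spanC 𝔡(𝔤) ⊆ End(V_ℂ)` and needs a form with RATIONAL values on rational pairs.
The two are bridged by:

* §1 **`trace_eq_trace_of_pairing`** (pure linear algebra, any field): for a pairing `β : W × W′ → K` with `β.flip : W′ → Dual W`
  bijective and operators `g ∈ End W`, `f ∈ End W′` with `β(g w, w′) = β(w, f w′)`, `tr f = tr g` (`f` is conjugate to the
  transpose of `g`: `LinearMap.trace_conj'`, `LinearMap.trace_transpose'`); **`flip_injective_of_isotropic`**,
  **`flip_bijective_of_isotropic`** — for an alternating non-degenerate form and two ISOTROPIC subspaces `U`, `U′` spanning the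
  space, the pairing `U′ → Dual U` is injective, and bijective when both are (dimension count).
* §2 (the unitary setting of `HodgeThetaSubalgebraUnitary`: `φ² = −d`, `μ² = −d`, `ψ` a polarization, weight one)
  **`UnitaryTheta.isCompl_eigenspace`** (`V_ℂ = W ⊕ W′`), **`UnitaryTheta.flip_pairing_bijective`** (`ψ_ℂ : W′ ⥲ Dual W`; `φ_ℂ` is
  `ψ_ℂ`-skew since the Rosati involution is complex conjugation on `k`, so `W`, `W′` are isotropic), and
  **`UnitaryTheta.trace_mul_eq_two_mul_trace_restrict`** — for `Z`, `Z′` commuting with `φ_ℂ` and `ψ_ℂ`-skew: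
  `tr_{V_ℂ}(Z Z′) = 2 · tr_W((Z Z′)|_W)` (the transpose of `(Z′ Z)|_W` is `(Z Z′)|_{W′}`, and `tr_W(Z′Z) = tr_W(Z Z′)`).
* §3 **`killingForm_spanC_baseChange_mem_range`** — for a bracket-closed rational `𝔡 ⊆ End_ℚ(V)` and the complex Lie subalgebra
  `𝔏′` with carrier `spanC 𝔡`: `κ_{𝔏′}(X_ℂ, Y_ℂ) = κ_𝔡(X, Y) ∈ ℚ` (`exists_lieEquiv_baseChange_spanC`, Mathlib
  `LieAlgebra.killingForm_of_equiv_apply`, the tree's `KillingBaseChange.killingForm_baseChange`) — with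
  `trace_baseChange_mul_baseChange_mem_range` of `HodgeThetaSubalgebraUnitarySocket` this is the `hrat` witness for every form
  `a·tr_V − c·κ`, `a, c ∈ ℚ`, on `spanC 𝔡`.
What remains for the socket (recorded in the cell's HANDOFF): the Killing form of the RESTRICTION algebra `𝔊 ⊆ End(W)` equals that
of `spanC 𝔤` along the restriction isomorphism (determination on `W`) — `LieAlgebra.killingForm_of_equiv_apply` once the
restriction is packaged as a `LieEquiv`.

## References

* [Ribet1983] K. A. Ribet, *Hodge classes on certain types of abelian varieties*, Amer. J. Math. 105 (1983), Thm. 3.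
* [MoonenZarhin1999LowDim] B. Moonen, Yu. Zarhin, Math. Ann. 315 (1999), §2 (2.3)–(2.4).
* [Deligne1982HodgeCycles] P. Deligne, *Hodge cycles on abelian varieties*, LNM 900 (1982), I §3 Prop. 3.4, 3.6.
* [Jacobson1962LieAlgebras] N. Jacobson, *Lie Algebras* (1962), Ch. III §4 (Killing form under base extension), Ch. X §1.
* [HoffmanKunze1971LinearAlgebra] K. Hoffman, R. Kunze, *Linear Algebra* (1971), §3.7 (transpose of a linear map).
-/

noncomputable section

open scoped TensorProduct

namespace Literature.AlgebraicGeometry.Motives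

namespace HodgeStructure

universe u

/-! ## §1 Traces through a perfect pairing; isotropic decompositions -/

/-- **`tr f = tr g` when `f ∈ End W′` is the transpose of `g ∈ End W` for a perfect pairing `β : W × W′ → K`**
(`β(g w, w′) = β(w, f w′)`, `β.flip : W′ ⥲ Dual W`): under `β.flip`, `f` is conjugate to `Dual.transpose g`.
[cite: HoffmanKunze1971LinearAlgebra, §3.7] -/
theorem trace_eq_trace_of_pairing {K W W' : Type*} [Field K] [AddCommGroup W] [Module K W] [AddCommGroup W']
    [Module K W'] [FiniteDimensional K W] (β : W →ₗ[K] W' →ₗ[K] K) (hβ : Function.Bijective β.flip) (g : Module.End K W)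
    (f : Module.End K W') (hadj : ∀ w w', β (g w) w' = β w (f w')) :
    LinearMap.trace K W' f = LinearMap.trace K W g := by
  set e : W' ≃ₗ[K] Module.Dual K W := LinearEquiv.ofBijective β.flip hβ with hedef
  have he : ∀ w', e w' = β.flip w' := fun w' => rfl
  have hconj : e.conj f = Module.Dual.transpose (R := K) g := by
    refine LinearMap.ext fun ξ => ?_
    obtain ⟨w', rfl⟩ := e.surjective ξ
    rw [LinearEquiv.conj_apply_apply, LinearEquiv.symm_apply_apply, Module.Dual.transpose_apply, he, he]
    refine LinearMap.ext fun w => ?_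
    rw [LinearMap.flip_apply, LinearMap.comp_apply, LinearMap.flip_apply, hadj]
  rw [← LinearMap.trace_conj' f e, hconj, LinearMap.trace_transpose']

/-- **The pairing `U′ → Dual U` induced by an alternating non-degenerate form is INJECTIVE when `U′` is isotropic and
`U + U′` is everything**: a `u′` orthogonal to `U` is orthogonal to `U ⊕ U′`, hence zero.
[cite: HoffmanKunze1971LinearAlgebra, §10.3] -/
theorem flip_injective_of_isotropic {K M : Type*} [Field K] [AddCommGroup M] [Module K M] (B : LinearMap.BilinForm K M)
    (hswap : ∀ x y, B y x = -B x y) (hnd : ∀ x, (∀ y, B x y = 0) → x = 0) {U U' : Submodule K M}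
    (hU' : ∀ x ∈ U', ∀ y ∈ U', B x y = 0) (hsup : ∀ v, ∃ u ∈ U, ∃ u' ∈ U', v = u + u') :
    Function.Injective ((B.domRestrict₁₂ U U').flip : U' →ₗ[K] Module.Dual K U) := by
  rw [injective_iff_map_eq_zero]
  intro w' hw'
  apply Subtype.ext
  change (w' : M) = 0
  refine hnd _ fun y => ?_
  obtain ⟨u, hu, u', hu', rfl⟩ := hsup y
  have h1 : B u w' = 0 := by
    have h := LinearMap.congr_fun hw' ⟨u, hu⟩
    rwa [LinearMap.flip_apply, LinearMap.domRestrict₁₂_apply, LinearMap.zero_apply] at h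
  rw [map_add, hswap u, h1, neg_zero, zero_add, hU' _ w'.2 _ hu']

/-- **… and BIJECTIVE when `U` is isotropic too** (the two injections `U′ ↪ Dual U`, `U ↪ Dual U′` force equal dimensions).
[cite: HoffmanKunze1971LinearAlgebra, §10.3] -/
theorem flip_bijective_of_isotropic {K M : Type*} [Field K] [AddCommGroup M] [Module K M] [FiniteDimensional K M]
    (B : LinearMap.BilinForm K M) (hswap : ∀ x y, B y x = -B x y) (hnd : ∀ x, (∀ y, B x y = 0) → x = 0)
    {U U' : Submodule K M} (hU : ∀ x ∈ U, ∀ y ∈ U, B x y = 0) (hU' : ∀ x ∈ U', ∀ y ∈ U', B x y = 0)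
    (hsup : ∀ v, ∃ u ∈ U, ∃ u' ∈ U', v = u + u') :
    Function.Bijective ((B.domRestrict₁₂ U U').flip : U' →ₗ[K] Module.Dual K U) := by
  have hinj := flip_injective_of_isotropic B hswap hnd hU' hsup
  have hsup' : ∀ v, ∃ u' ∈ U', ∃ u ∈ U, v = u' + u := fun v => by
    obtain ⟨u, hu, u', hu', rfl⟩ := hsup v
    exact ⟨u', hu', u, hu, add_comm _ _⟩
  have hinj' := flip_injective_of_isotropic B hswap hnd hU hsup'
  have h1 := LinearMap.finrank_le_finrank_of_injective hinj
  have h2 := LinearMap.finrank_le_finrank_of_injective hinj'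
  rw [Subspace.dual_finrank_eq] at h1 h2
  exact ⟨hinj, (LinearMap.injective_iff_surjective_of_finrank_eq_finrank
    (by rw [Subspace.dual_finrank_eq]; omega)).mp hinj⟩

/-! ## §2 `V_ℂ = W ⊕ W′`, the perfect pairing `ψ_ℂ : W′ ⥲ Dual W`, and `tr_V = 2·tr_W` -/

section Unitary

variable {V : Type u} [AddCommGroup V] [Module ℚ V] {n : ℤ}

/-- **`V_ℂ = W ⊕ W′`** for `W = ker(φ_ℂ − μ)`, `W′ = ker(φ_ℂ + μ)`, `φ² = −d`, `μ² = −d`, `d > 0`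
(`UnitaryTheta.exists_eigen_add_eigen`, `eq_zero_of_mem_eigenspace_of_mem_eigenspace_neg`).
[cite: MoonenZarhin1999LowDim, §2 (2.3)] [cite: Deligne1982HodgeCycles, I §3] -/
theorem UnitaryTheta.isCompl_eigenspace {φ : Module.End ℚ V} {d : ℚ} (hd : 0 < d) (hφ2 : φ * φ = -(d • 1))
    {μ : ℂ} (hμ : μ ^ 2 = -(d : ℂ)) :
    IsCompl (Module.End.eigenspace (φ.baseChange ℂ) μ) (Module.End.eigenspace (φ.baseChange ℂ) (-μ)) := by
  have hμ0 := (UnitaryTheta.conj_eq_neg_of_sq hd hμ).1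
  refine ⟨Submodule.disjoint_def.2 fun x hx hx' =>
      UnitaryTheta.eq_zero_of_mem_eigenspace_of_mem_eigenspace_neg hμ0 hx hx', codisjoint_iff.2 ?_⟩
  rw [eq_top_iff]
  intro x _
  obtain ⟨w, hw, w', hw', rfl⟩ := UnitaryTheta.exists_eigen_add_eigen hφ2 hμ hμ0 x
  exact Submodule.add_mem_sup hw hw'

/-- **`ψ_ℂ : W′ ⥲ Dual W` is bijective** (weight one; `φ_ℂ` is `ψ_ℂ`-skew — the Rosati involution is complex conjugation on `k`
— so `W`, `W′` are isotropic, `V_ℂ = W ⊕ W′`, and `ψ_ℂ` is non-degenerate and alternating).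
[cite: Deligne1982HodgeCycles, I §3] [cite: MoonenZarhin1999LowDim, §2 (2.3)] -/
theorem UnitaryTheta.flip_pairing_bijective [Module.Finite ℚ V] [Nontrivial V] (H : HodgeStructure V n) (hn : n = 1)
    (ψ : H.Polarization) {φ : Module.End ℚ V} (hφE : φ ∈ H.endAlg) {d : ℚ} (hd : 0 < d) (hφ2 : φ * φ = -(d • 1))
    (hE : ∀ a ∈ H.endAlg, ∃ x y : ℚ, a = x • 1 + y • φ) {μ : ℂ} (hμ : μ ^ 2 = -(d : ℂ)) :
    Function.Bijective
      (((ψ.form.baseChange ℂ).domRestrict₁₂ (Module.End.eigenspace (φ.baseChange ℂ) μ)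
        (Module.End.eigenspace (φ.baseChange ℂ) (-μ))).flip :
        ↥(Module.End.eigenspace (φ.baseChange ℂ) (-μ)) →ₗ[ℂ] Module.Dual ℂ ↥(Module.End.eigenspace (φ.baseChange ℂ) μ)) := by
  subst hn
  have hμ0 := (UnitaryTheta.conj_eq_neg_of_sq hd hμ).1
  have hφskew : ∀ x y, ψ.form.baseChange ℂ (φ.baseChange ℂ x) y + ψ.form.baseChange ℂ x (φ.baseChange ℂ y) = 0 :=
    ThetaSubalgebra.formBaseChange_add_eq_zero_of_skew ψ
      (UnitaryTheta.form_apply_add_form_apply_eq_zero H ψ hφE hd hφ2 hE)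
  refine flip_bijective_of_isotropic (ψ.form.baseChange ℂ) (form_baseChange_swap_of_odd H odd_one ψ)
    (fun x hx => ψ.eq_zero_of_forall_form_eq_zero hx)
    (fun x hx y hy => UnitaryTheta.form_eq_zero_of_mem_eigenspace hφskew hμ0 hx hy)
    (fun x hx y hy => UnitaryTheta.form_eq_zero_of_mem_eigenspace hφskew (neg_ne_zero.2 hμ0) hx hy) fun v => ?_
  obtain ⟨w, hw, w', hw', rfl⟩ := UnitaryTheta.exists_eigen_add_eigen hφ2 hμ hμ0 v
  exact ⟨w, hw, w', hw', rfl⟩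

/-- **`tr_{V_ℂ}(Z Z′) = 2 · tr_W((Z Z′)|_W)`** for `Z`, `Z′` commuting with `φ_ℂ` and `ψ_ℂ`-skew (weight one, `End_Hdg = ℚ + ℚφ`).
PROOF: `V_ℂ = W ⊕ W′` with both summands stable, so `tr_V = tr_W + tr_{W′}` (`LinearMap.trace_eq_sum_trace_restrict`); the
transpose of `(Z′Z)|_W` for the perfect pairing `ψ_ℂ : W × W′ → ℂ` is `(ZZ′)|_{W′}` (`ψ_ℂ(Z′Z w, w′) = ψ_ℂ(w, Z Z′ w′)` by
skewness twice), so `tr_{W′}(ZZ′) = tr_W(Z′Z) = tr_W(ZZ′)` (§1 and `LinearMap.trace_mul_comm`).  In particular the rational trace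
form of `V` is twice the trace form of the restriction algebra on `W` (Gordon: `𝔲_K(V,ψ)_ℂ ≅ 𝔤𝔩(W)`, `Y|_{W′} = −(Y|_W)ᵗ`).
[cite: Deligne1982HodgeCycles, I §3] [cite: MoonenZarhin1999LowDim, §2 (2.3)] [cite: Ribet1983, Thm. 3] -/
theorem UnitaryTheta.trace_mul_eq_two_mul_trace_restrict [Module.Finite ℚ V] [Nontrivial V] (H : HodgeStructure V n)
    (hn : n = 1) (ψ : H.Polarization) {φ : Module.End ℚ V} (hφE : φ ∈ H.endAlg) {d : ℚ} (hd : 0 < d)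
    (hφ2 : φ * φ = -(d • 1)) (hE : ∀ a ∈ H.endAlg, ∃ x y : ℚ, a = x • 1 + y • φ) {μ : ℂ} (hμ : μ ^ 2 = -(d : ℂ))
    {Z Z' : Module.End ℂ (ℂ ⊗[ℚ] V)} (hZφ : Z * φ.baseChange ℂ = φ.baseChange ℂ * Z)
    (hZ'φ : Z' * φ.baseChange ℂ = φ.baseChange ℂ * Z')
    (hZskew : ∀ x y, ψ.form.baseChange ℂ (Z x) y + ψ.form.baseChange ℂ x (Z y) = 0)
    (hZ'skew : ∀ x y, ψ.form.baseChange ℂ (Z' x) y + ψ.form.baseChange ℂ x (Z' y) = 0)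
    (hW : ∀ w ∈ Module.End.eigenspace (φ.baseChange ℂ) μ, (Z * Z') w ∈ Module.End.eigenspace (φ.baseChange ℂ) μ) :
    LinearMap.trace ℂ (ℂ ⊗[ℚ] V) (Z * Z') =
      2 * LinearMap.trace ℂ ↥(Module.End.eigenspace (φ.baseChange ℂ) μ) ((Z * Z').restrict hW) := by
  classical
  set W := Module.End.eigenspace (φ.baseChange ℂ) μ with hWdef
  set W' := Module.End.eigenspace (φ.baseChange ℂ) (-μ) with hW'def
  -- stability of `W`, `W′` under `Z`, `Z′`
  have hZW : ∀ w ∈ W, Z w ∈ W := fun w hw => UnitaryTheta.apply_mem_eigenspace_of_commute hZφ hw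
  have hZ'W : ∀ w ∈ W, Z' w ∈ W := fun w hw => UnitaryTheta.apply_mem_eigenspace_of_commute hZ'φ hw
  have hZW' : ∀ w ∈ W', Z w ∈ W' := fun w hw => UnitaryTheta.apply_mem_eigenspace_of_commute hZφ hw
  have hZ'W' : ∀ w ∈ W', Z' w ∈ W' := fun w hw => UnitaryTheta.apply_mem_eigenspace_of_commute hZ'φ hw
  have hW' : ∀ w ∈ W', (Z * Z') w ∈ W' := fun w hw => hZW' _ (hZ'W' w hw)
  have hWZ'Z : ∀ w ∈ W, (Z' * Z) w ∈ W := fun w hw => hZ'W _ (hZW w hw)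
  -- `tr_V = tr_W + tr_{W′}`
  set N : Bool → Submodule ℂ (ℂ ⊗[ℚ] V) := fun b => cond b W W' with hNdef
  have hNt : N true = W := rfl
  have hNf : N false = W' := rfl
  have hint : DirectSum.IsInternal N := by
    rw [DirectSum.isInternal_submodule_iff_isCompl N (i := true) (j := false) (by decide)
      (by ext b; cases b <;> simp)]
    exact UnitaryTheta.isCompl_eigenspace hd hφ2 hμ
  have hf : ∀ b, Set.MapsTo (Z * Z') (N b) (N b) := fun b => by
    cases b
    · exact fun w hw => hW' w hw
    · exact fun w hw => hW w hw
  have hsum := LinearMap.trace_eq_sum_trace_restrict hint hf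
  rw [Fintype.sum_bool] at hsum
  -- `tr_{W′}(ZZ′) = tr_W(Z′Z)` through the pairing
  have hbij := UnitaryTheta.flip_pairing_bijective H hn ψ hφE hd hφ2 hE hμ
  have hpair : LinearMap.trace ℂ ↥W' ((Z * Z').restrict hW') = LinearMap.trace ℂ ↥W ((Z' * Z).restrict hWZ'Z) := by
    refine trace_eq_trace_of_pairing _ hbij ((Z' * Z).restrict hWZ'Z) ((Z * Z').restrict hW') fun w w' => ?_
    rw [LinearMap.domRestrict₁₂_apply, LinearMap.domRestrict₁₂_apply, LinearMap.coe_restrict_apply,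
      LinearMap.coe_restrict_apply, Module.End.mul_apply, Module.End.mul_apply]
    have h1 := hZ'skew (Z (w : ℂ ⊗[ℚ] V)) (w' : ℂ ⊗[ℚ] V)
    have h2 := hZskew (w : ℂ ⊗[ℚ] V) (Z' (w' : ℂ ⊗[ℚ] V))
    linear_combination h1 - h2
  -- `tr_W(Z′Z) = tr_W(ZZ′)`
  have hcomm : LinearMap.trace ℂ ↥W ((Z' * Z).restrict hWZ'Z) = LinearMap.trace ℂ ↥W ((Z * Z').restrict hW) := by
    have h1 : (Z' * Z).restrict hWZ'Z = Z'.restrict hZ'W * Z.restrict hZW := LinearMap.ext fun w => Subtype.ext rfl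
    have h2 : (Z * Z').restrict hW = Z.restrict hZW * Z'.restrict hZ'W := LinearMap.ext fun w => Subtype.ext rfl
    rw [h1, h2, LinearMap.trace_mul_comm]
  have ht : LinearMap.trace ℂ ↥(N true) ((Z * Z').restrict (hf true)) = LinearMap.trace ℂ ↥W ((Z * Z').restrict hW) := rfl
  have hf' : LinearMap.trace ℂ ↥(N false) ((Z * Z').restrict (hf false)) = LinearMap.trace ℂ ↥W' ((Z * Z').restrict hW') :=
    rfl
  rw [hsum, ht, hf', hpair, hcomm, two_mul]

end Unitary

/-! ## §3 Rationality of the Killing form on rational pairs -/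

section Killing

variable {V : Type u} [AddCommGroup V] [Module ℚ V] [Module.Finite ℚ V]

/-- **`κ_{𝔏′}(X_ℂ, Y_ℂ) = κ_𝔡(X, Y) ∈ ℚ`** for a bracket-closed rational `𝔡 ⊆ End_ℚ(V)` (as a `LieSubalgebra` `𝔏`), the complex Lie
subalgebra `𝔏′` with carrier `spanC 𝔡`, and rational `X, Y ∈ 𝔡`: transport along `ℂ ⊗_ℚ 𝔏 ≃ₗ⁅ℂ⁆ 𝔏′`
(`exists_lieEquiv_baseChange_spanC`; Mathlib `LieAlgebra.killingForm_of_equiv_apply`) and `κ_{ℂ ⊗ 𝔏} = (κ_𝔏)_ℂ`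
(`KillingBaseChange.killingForm_baseChange`).  Jacobson: the Killing form is defined over the ground field.
[cite: Jacobson1962LieAlgebras, Ch. III §4 and Ch. X §1] [cite: Deligne1982HodgeCycles, I §3 (proof of Prop. 3.4)] -/
theorem killingForm_spanC_baseChange_mem_range :
    letI : LieRing (Module.End ℚ V) := LieRing.ofAssociativeRing
    letI : LieRing (Module.End ℂ (ℂ ⊗[ℚ] V)) := LieRing.ofAssociativeRing
    ∀ (𝔏 : LieSubalgebra ℚ (Module.End ℚ V)) (𝔏' : LieSubalgebra ℂ (Module.End ℂ (ℂ ⊗[ℚ] V)))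
      (h𝔏' : 𝔏'.toSubmodule = spanC 𝔏.toSubmodule) (X Y : 𝔏)
      (hX : (X : Module.End ℚ V).baseChange ℂ ∈ 𝔏') (hY : (Y : Module.End ℚ V).baseChange ℂ ∈ 𝔏'),
      ∃ q : ℚ, killingForm ℂ 𝔏' ⟨(X : Module.End ℚ V).baseChange ℂ, hX⟩ ⟨(Y : Module.End ℚ V).baseChange ℂ, hY⟩ = (q : ℂ) := by
  letI : LieRing (Module.End ℚ V) := LieRing.ofAssociativeRing
  letI : LieRing (Module.End ℂ (ℂ ⊗[ℚ] V)) := LieRing.ofAssociativeRing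
  intro 𝔏 𝔏' h𝔏' X Y hX hY
  haveI : Module.Finite ℚ 𝔏 := Module.Finite.of_injective 𝔏.toSubmodule.subtype Subtype.val_injective
  obtain ⟨e, he⟩ := exists_lieEquiv_baseChange_spanC 𝔏 𝔏' h𝔏'
  have heX : e ((1 : ℂ) ⊗ₜ[ℚ] X) = ⟨(X : Module.End ℚ V).baseChange ℂ, hX⟩ :=
    Subtype.ext (by rw [he, one_smul])
  have heY : e ((1 : ℂ) ⊗ₜ[ℚ] Y) = ⟨(Y : Module.End ℚ V).baseChange ℂ, hY⟩ :=
    Subtype.ext (by rw [he, one_smul])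
  refine ⟨killingForm ℚ 𝔏 X Y, ?_⟩
  rw [← heX, ← heY, LieAlgebra.killingForm_of_equiv_apply,
    Literature.Algebra.Lie.KillingBaseChange.killingForm_baseChange, LinearMap.BilinForm.baseChange_tmul, one_mul,
    Rat.smul_one_eq_cast]

end Killing

end HodgeStructure

end Literature.AlgebraicGeometry.Motives

end
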